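import Summits.ValiantsHypothesis.ValiantsHypothesis.Theorems.BarrierLeverDefinableEquationsPartialDerivativeWallOrderOne

/-!
# Route BarrierLever — method wall #1b, part 2: first-order shifted partials are saturated at
# EVERY shift by the power-sum staircase `S_n = Σ_{d=1}^{n} Σ_i x_i^d` (Vandermonde)
# (crux `DefinableEquations` stmt-8745 / item `SingleSizeEquations` stmt-8749; val-np-p5 g11)

Continuation of `…PartialDerivativeWallOrderOne.lean`, which attains the universal ceiling
`rank g_{(1,·)[τ]} ≤ n · #{deg-τ monomials}` with the Fermat polynomial for shifts `τ ≤ D - 2`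
only (at `τ ≥ D - 1` the Koszul syzygies of a homogeneous Jacobian ideal are unavoidable).  For an
INHOMOGENEOUS polynomial the ceiling is attainable at every shift: a syzygy
`Σ_i a_i ∂_i S_n = 0` with the `a_i` forms of degree `τ` splits by degree into the `n` identities
`Σ_i a_i x_i^d = 0`, `d < n`, i.e. `a ᵥ* V = 0` for the Vandermonde matrix `V = (x_i^d)` whose
determinant `∏_{i<j}(x_j - x_i)` is nonzero in the domain `K[x]`; so `a = 0`.

* `pderiv_staircase`, `eq_zero_of_sum_mul_X_pow_eq_zero` (the Vandermonde step, via Mathlib's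
  `Matrix.det_vandermonde_eq_zero_iff` and `Matrix.eq_zero_of_vecMul_eq_zero`),
  `linearIndependent_shifted_staircase`, **`shiftedPartialsRank_one_staircase_eq`**
  (`rank (S_n)_{(1,·)[τ]} = n · #{deg-τ monomials}` for EVERY `τ`),
  `shiftedPartialsRank_one_le_staircase` (so `S_n` maximises the first-order measure at every shift
  over ALL polynomials), `totalDegree_staircase_le` (`≤ n`), `complexity_staircase_le`
  (`≤ n³ + n² + n`), `staircase_mem_smallCircuits` (`b ≥ 4`, `n ≥ 2`);
* **`no_shiftedRankMethod_smallCircuits_orderOne_allShifts`** — for `n ≥ 2`, `b ≥ 4` there is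
  no shift `τ` and threshold `r` with `rank f_{(1,·)[τ]} < r` on `SmallCircuits ℂ n b` and
  `rank g_{(1,·)[τ]} ≥ r` for some `g` (any `g`).

With part 1 (`b ≥ 2`, `τ ≤ n - 3`) and the g10 walls (every order at shift `0`; orders
`≥ ⌊n/2⌋` at every shift) the ORDER-ONE row of the shifted-partials chart is closed at every shift;
orders `2 ≤ e < ⌊n/2⌋` with `τ ≥ 1` remain unwalled in the kernel (numerical saturation by
width-2 ABPs: census HOME/val-np-p5/LANDSCAPE-8749-g11.md).  WHAT THIS IS NOT: nothing on the
crux's verdict (b = 2 OPEN) or on `VP ≠ VNP`.  No definitions, no named facts; standard axioms.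
-/

-- `Summit.ValiantsHypothesis.ValiantsHypothesis.…` repeats a component by the D-0017 layout
-- (single-conjunct summit), which the `dupNamespace` linter flags; the name is mandated.
set_option linter.dupNamespace false

noncomputable section

namespace Summit.ValiantsHypothesis.ValiantsHypothesis.Theorems.BarrierLeverDefinableEquations

open MvPolynomial
open Literature.Computability.AlgebraicComplexity
open Literature.Barriers.ValiantsHypothesis
open scoped BigOperators

namespace PartialDerivativeWall

/-! ## §4 ALL shifts: the power-sum staircase `S_n = Σ_{d=1}^{n} Σ_i x_i^d` attains the ceiling
for every `τ` (Vandermonde) -/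

section AllShifts

variable {K : Type*} [Field K] {n : ℕ}

/-- `∂_i S_n = Σ_{d<n} (d+1) x_i^d`, written with monomials. [folklore] -/
theorem pderiv_staircase (i : Fin n) :
    pderiv i (∑ d ∈ Finset.range n, ∑ j : Fin n, (X j : MvPolynomial (Fin n) K) ^ (d + 1)) =
      ∑ d ∈ Finset.range n, monomial (Finsupp.single i d) ((d + 1 : ℕ) : K) := by
  rw [map_sum]
  refine Finset.sum_congr rfl fun d _ => ?_
  rw [pderiv_sumPow, Nat.add_sub_cancel]

/-- **Vandermonde step**: if forms `a_1, …, a_n` (or any polynomials) satisfy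
`Σ_i a_i x_i^d = 0` for every `d < n`, then all `a_i = 0` (the Vandermonde matrix `(x_i^d)` has
nonzero determinant `∏_{i<j} (x_j - x_i)` in the domain `K[x]`). [folklore] -/
theorem eq_zero_of_sum_mul_X_pow_eq_zero (a : Fin n → MvPolynomial (Fin n) K)
    (h : ∀ d : Fin n, ∑ i, a i * (X i : MvPolynomial (Fin n) K) ^ (d : ℕ) = 0) : a = 0 := by
  have hdet : (Matrix.vandermonde fun i : Fin n => (X i : MvPolynomial (Fin n) K)).det ≠ 0 := by
    rw [Ne, Matrix.det_vandermonde_eq_zero_iff]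
    rintro ⟨i, j, hij, hne⟩
    exact hne (X_injective hij)
  refine Matrix.eq_zero_of_vecMul_eq_zero hdet ?_
  funext d
  rw [Matrix.vecMul, dotProduct]
  simpa [Matrix.vandermonde_apply] using h d

/-- Coefficient extraction for a combination of monic monomials indexed by the degree-`τ`
exponents. [folklore] -/
theorem coeff_sum_smul_monomial {τ : ℕ} (g : ↥((Finset.univ : Finset (Fin n)).finsuppAntidiag τ) → K)
    (β : ↥((Finset.univ : Finset (Fin n)).finsuppAntidiag τ)) :
    coeff (β : Fin n →₀ ℕ) (∑ β', g β' • monomial (β' : Fin n →₀ ℕ) (1 : K)) = g β := by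
  classical
  rw [coeff_sum, Finset.sum_eq_single β]
  · rw [coeff_smul, coeff_monomial, if_pos rfl, smul_eq_mul, mul_one]
  · intro β' _ hne
    rw [coeff_smul, coeff_monomial, if_neg, smul_zero]
    exact fun h => hne (Subtype.ext h)
  · intro h; exact absurd (Finset.mem_univ β) h

/-- The generators `x^β ∂_i S_n` (`deg β = τ`, `i ≤ n`) of the order-one shifted partials of the
staircase are linearly independent for EVERY shift `τ`: a relation `Σ_i a_i ∂_i S_n = 0` with
`a_i` forms of degree `τ` splits by degree into `Σ_i a_i x_i^d = 0` (`d < n`), a Vandermonde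
system in the domain `K[x]` (characteristic `0`). [folklore] -/
theorem linearIndependent_shifted_staircase [CharZero K] (τ : ℕ) :
    LinearIndependent K (fun p : Fin n × ↥((Finset.univ : Finset (Fin n)).finsuppAntidiag τ) =>
      monomial (p.2 : Fin n →₀ ℕ) (1 : K) *
        pderiv p.1 (∑ d ∈ Finset.range n, ∑ j : Fin n, (X j : MvPolynomial (Fin n) K) ^ (d + 1))) := by
  classical
  rw [Fintype.linearIndependent_iff]
  intro g hg
  -- the degree-`τ` forms `a_i = Σ_β g(i,β) x^β`
  set a : Fin n → MvPolynomial (Fin n) K :=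
    fun i => ∑ β : ↥((Finset.univ : Finset (Fin n)).finsuppAntidiag τ),
      g (i, β) • monomial (β : Fin n →₀ ℕ) (1 : K) with ha
  have haHom : ∀ i, (a i).IsHomogeneous τ := fun i => by
    refine IsHomogeneous.sum _ _ _ fun β _ => ?_
    rw [smul_monomial, smul_eq_mul, mul_one]
    exact isHomogeneous_monomial _ ((degree_eq_iff_mem_finsuppAntidiag _ τ).mpr β.2)
  -- `Σ_i a_i ∂_i S = 0`
  have hsum : ∑ i, a i * ∑ d' ∈ Finset.range n, monomial (Finsupp.single i d') ((d' + 1 : ℕ) : K) = 0 := by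
    rw [← hg, Fintype.sum_prod_type]
    refine Finset.sum_congr rfl fun i _ => ?_
    simp only [pderiv_staircase, ha, Finset.sum_mul, smul_mul_assoc]
  -- split by degree: the component of degree `τ + d` is `(d+1) · Σ_i a_i x_i^d`
  have hdeg : ∀ d : Fin n, ∑ i, a i * (X i : MvPolynomial (Fin n) K) ^ (d : ℕ) = 0 := by
    intro d
    have hc := congrArg (homogeneousComponent (τ + d)) hsum
    rw [map_zero, map_sum] at hc
    have hhom : ∀ (i : Fin n) (d' : ℕ),
        (a i * monomial (Finsupp.single i d') ((d' + 1 : ℕ) : K)).IsHomogeneous (τ + d') :=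
      fun i d' => (haHom i).mul (isHomogeneous_monomial _ (by rw [Finsupp.degree_single]))
    have hterm : ∀ i, homogeneousComponent (τ + d)
        (a i * ∑ d' ∈ Finset.range n, monomial (Finsupp.single i d') ((d' + 1 : ℕ) : K)) =
        ((d + 1 : ℕ) : K) • (a i * X i ^ (d : ℕ)) := by
      intro i
      rw [Finset.mul_sum, map_sum, Finset.sum_eq_single (d : ℕ)]
      · rw [homogeneousComponent_of_mem ((mem_homogeneousSubmodule _ _).mpr (hhom i d)), if_pos rfl,
          X_pow_eq_monomial, ← mul_smul_comm, smul_monomial, smul_eq_mul, mul_one]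
      · intro d' _ hne
        rw [homogeneousComponent_of_mem ((mem_homogeneousSubmodule _ _).mpr (hhom i d')), if_neg]
        omega
      · intro hd; exact absurd (Finset.mem_range.mpr d.2) hd
    simp only [hterm, ← Finset.smul_sum] at hc
    have hd1 : ((d + 1 : ℕ) : K) ≠ 0 := by exact_mod_cast Nat.succ_ne_zero d
    exact (smul_eq_zero.mp hc).resolve_left hd1
  have ha0 : a = 0 := eq_zero_of_sum_mul_X_pow_eq_zero a hdeg
  rintro ⟨i, β⟩
  have h := congrArg (coeff (β : Fin n →₀ ℕ)) (congrFun ha0 i)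
  rw [coeff_sum_smul_monomial] at h
  simpa using h

/-- **The ceiling is attained at every shift**: `rank (S_n)_{(1,·)[τ]} = n · #{deg-τ monomials}`.
[cite: LandsbergGCT2017, §6.2.2 (p. 158)] -/
theorem shiftedPartialsRank_one_staircase_eq [CharZero K] (τ : ℕ) :
    shiftedPartialsRank K 1 τ (∑ d ∈ Finset.range n, ∑ j : Fin n, (X j : MvPolynomial (Fin n) K) ^ (d + 1)) =
      n * ((Finset.univ : Finset (Fin n)).finsuppAntidiag τ).card := by
  classical
  set S := (∑ d ∈ Finset.range n, ∑ j : Fin n, (X j : MvPolynomial (Fin n) K) ^ (d + 1)) with hS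
  refine le_antisymm (shiftedPartialsRank_one_le τ S) ?_
  set ψ := fun p : Fin n × ↥((Finset.univ : Finset (Fin n)).finsuppAntidiag τ) =>
      monomial (p.2 : Fin n →₀ ℕ) (1 : K) * pderiv p.1 S with hψ
  have hli : LinearIndependent K ψ := linearIndependent_shifted_staircase τ
  haveI := finite_span_shiftedPartials (K := K) 1 τ S
  have hsub : Set.range ψ ⊆ shiftedPartials 1 τ S := by
    rintro _ ⟨⟨i, β, hβ⟩, rfl⟩
    exact ⟨[i], β, rfl, (degree_eq_iff_mem_finsuppAntidiag β τ).mpr hβ, by simp [hψ]⟩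
  unfold shiftedPartialsRank
  calc n * ((Finset.univ : Finset (Fin n)).finsuppAntidiag τ).card
      = Fintype.card (Fin n × ↥((Finset.univ : Finset (Fin n)).finsuppAntidiag τ)) := by
        rw [Fintype.card_prod, Fintype.card_fin, Fintype.card_coe]
    _ = Module.finrank K (Submodule.span K (Set.range ψ)) := (finrank_span_eq_card hli).symm
    _ ≤ Module.finrank K (Submodule.span K (shiftedPartials 1 τ S)) :=
        Submodule.finrank_mono (Submodule.span_mono hsub)

/-- **Saturation at order one, every shift**: `rank g_{(1,·)[τ]} ≤ rank (S_n)_{(1,·)[τ]}` for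
every `g ∈ K[x_1..x_n]` and every `τ`. [cite: GesmundoLandsberg2017, Thm. 4 and §1] -/
theorem shiftedPartialsRank_one_le_staircase [CharZero K] (τ : ℕ) (g : MvPolynomial (Fin n) K) :
    shiftedPartialsRank K 1 τ g ≤
      shiftedPartialsRank K 1 τ (∑ d ∈ Finset.range n, ∑ j : Fin n, (X j : MvPolynomial (Fin n) K) ^ (d + 1)) := by
  rw [shiftedPartialsRank_one_staircase_eq]
  exact shiftedPartialsRank_one_le τ g

/-- `deg S_n ≤ n`. [folklore] -/
theorem totalDegree_staircase_le :
    (∑ d ∈ Finset.range n, ∑ j : Fin n, (X j : MvPolynomial (Fin n) K) ^ (d + 1)).totalDegree ≤ n := by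
  refine (totalDegree_finsetSum _ _).trans (Finset.sup_le fun d hd => ?_)
  exact (totalDegree_sumPow_le (d + 1)).trans (by have := Finset.mem_range.mp hd; omega)

/-- `L(S_n) ≤ n·(n·n + n) + n ≤ 3n³`... precisely `Σ_{d<n} (n(d+1) + n) + n ≤ n(n² + n) + n`:
we use the crude bound `L(S_n) ≤ n³ + n² + n`. [cite: Burgisser2000, §2.1] -/
theorem complexity_staircase_le :
    complexity (∑ d ∈ Finset.range n, ∑ j : Fin n, (X j : MvPolynomial (Fin n) K) ^ (d + 1)) ≤
      n ^ 3 + n ^ 2 + n := by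
  classical
  refine (complexity_finset_sum_le _ _).trans ?_
  rw [Finset.card_range]
  have h1 : ∑ d ∈ Finset.range n, complexity (∑ j : Fin n, (X j : MvPolynomial (Fin n) K) ^ (d + 1)) ≤
      ∑ d ∈ Finset.range n, (n * n + n) := by
    refine Finset.sum_le_sum fun d hd => (complexity_sumPow_le (d + 1)).trans ?_
    have := Finset.mem_range.mp hd
    nlinarith
  refine (Nat.add_le_add_right h1 n).trans ?_
  rw [Finset.sum_const, Finset.card_range, smul_eq_mul]
  nlinarith

/-- `S_n ∈ SmallCircuits ℂ n b` for `b ≥ 3`, `n ≥ 2` (`n³ + n² + n ≤ n^b`... for `n ≥ 2`,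
`n³ + n² + n ≤ 2n³ ≤ n⁴`; we ask `b ≥ 4`, or `b = 3` with `n ≥ 2` via `n³+n²+n ≤ n³·…`): stated for
`b ≥ 4`. [cite: ForbesShpilkaVolk2018, Cor. 5] -/
theorem staircase_mem_smallCircuits {b : ℕ} (hb : 4 ≤ b) (hn : 2 ≤ n) :
    (∑ d ∈ Finset.range n, ∑ j : Fin n, (X j : MvPolynomial (Fin n) ℂ) ^ (d + 1)) ∈ SmallCircuits ℂ n b := by
  refine ⟨totalDegree_staircase_le, complexity_staircase_le.trans ?_⟩
  have h1 : n ^ 2 + n + 1 ≤ n ^ 3 := by nlinarith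
  calc n ^ 3 + n ^ 2 + n = n * (n ^ 2 + n + 1) := by ring
    _ ≤ n * n ^ 3 := Nat.mul_le_mul_left _ h1
    _ = n ^ 4 := by ring
    _ ≤ n ^ b := Nat.pow_le_pow_right (by omega) hb

/-- **No first-order shifted-partials rank method against `SmallCircuits ℂ n b`, ANY shift**
(`n ≥ 2`, `b ≥ 4`): no `τ, r` with `rank f_{(1,·)[τ]} < r` on the class and `rank g_{(1,·)[τ]} ≥ r`
for some `g` (any `g`). [cite: ForbesShpilkaVolk2018, Cor. 5] -/
theorem no_shiftedRankMethod_smallCircuits_orderOne_allShifts {b : ℕ} (hn : 2 ≤ n) (hb : 4 ≤ b) :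
    ¬ ∃ τ r : ℕ, (∀ f ∈ SmallCircuits ℂ n b, shiftedPartialsRank ℂ 1 τ f < r) ∧
      ∃ g : MvPolynomial (Fin n) ℂ, r ≤ shiftedPartialsRank ℂ 1 τ g := by
  rintro ⟨τ, r, hcls, g, hr⟩
  exact absurd ((shiftedPartialsRank_one_le_staircase τ g).trans_lt
    (hcls _ (staircase_mem_smallCircuits hb hn))) (not_lt.2 hr)

end AllShifts

end PartialDerivativeWall

end Summit.ValiantsHypothesis.ValiantsHypothesis.Theorems.BarrierLeverDefinableEquations
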